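import Summits.MatrixMultiplication.MatrixMultiplication.Theorems.AbelianSTPPCensusShapeCertVQCandC
import Summits.MatrixMultiplication.MatrixMultiplication.Theorems.AbelianSTPPCensusE3PlusShape

/-!
# Abelian STPP census — the vQ certificate checker `ShapeCertVQ` (T_E beyond 337 under vQ := vP ∧ E3⁺): definitions

Cell mm-stpp, rung F-M1; successor kernel item VQ-CERT (HOME/mm-stpp-eng-2/energy3/VQ-CERT-SPEC.md), filed in support of the
closed crux item stmt-MatrixMultiplication-19191 (`ShapeExclusionVP337`, T_E/337); seat mm-stpp-vp-p2 (gen 1).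

`checkQ M` is theory g6's vP certificate search `ShapeCertVP.checkV` (`…ShapeCertVPDefs`: eng-2's shape records and hereditary
vM test `feasP`, the U11-G node kill in credit form `killV`, the generalised Grynkiewicz continuation bound, suffix-free level
tables) with three changes, for the orders `338 ≤ M ≤ 489` where vP alone is no longer exclusionary (`shapeExclusionVP_false_at_338`):
* the **E3⁺ node kill** `killE`: a prefix one of whose members `t` (with `2V_t > M`) violates the refined three-room energy
  inequality of `STPPThreeRoomEnergy.three_room_energy_plus` (p491649) — on shape data, `V_t² < e3pLHS M a_t b_t c_t S_A S_B S_C`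
  with eng-2 g5's `STPPThreeRoomEnergy.e3pLHS` (`…E3PlusShape`, p519811) and the off-member packing sums of the PREFIX — is dead
  together with all its completions (the kill is hereditary: `STPPThreeRoomEnergy.e3pLHS_mono`); it is tested at every node
  before the beat test, so a beating prefix refutes the certificate only if it survives E3⁺;
* the **static data at universe order `489`** (`…ShapeCertVQData`, `…ShapeCertVQCandA/B/C`): gains `⌈10⁶V^{5/6}⌉` to `V ≤ 512`,
  the level tables `tabRQ` / `tabGQ`, the candidate lists;
* the **level floor `loLev = 11`** (v2: `27`): every universe shape (levels `12 … 58`) is a search candidate, the floor rows of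
  the tables are zero and the closure at the end of a candidate walk is the bare beat test of the prefix.  (Above the vP wall
  a nearly beating prefix such as `(6,6,6)⁴` at order `353` is completed to a beating vP-admissible list by tiny members of
  level `≤ 27` — `(1,1,2)` has level `22` — which only E3⁺ kills; the v2 table closure cannot see that, so they are enumerated.)
Orders are split for the kernel by ROOT SEGMENTS (`rootSegQ M i n`: the root's candidate walk restricted to the candidates
`i … i+n−1`, each with its full continuation pool), assembled by `…ShapeCertVQSearch.checkQ_of_rootSegs`.
Soundness (`checkQ M = true`, `M ≤ 489` ⇒ no shape multiset inside the universe of order `M` satisfying `AdmM`, `AdmG` and the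
E3⁺ condition `AdmE` has integer gain above `10⁶·M`) is proved in `…ShapeCertVQ{Semantics,Tables,Budgets,Spec,Bounds,Search}`,
the bridge to `SieveAdmissibleVP ∧ E3pAdm → ¬ Beats (5/2)` in `…ShapeCertVQFinal`, kernel evaluations in `…ShapeCertVQEval*`.
Sizing (seat folder, Lean `#eval` of this very search): verdict EXCLUDED at every sampled order `338 … 440`; candidate visits
per order `5·10³–1.7·10⁴` on `338–352`, `2–6·10⁴` on `353–390`, `10⁵–5·10⁵` on `395–420`, `1.6·10⁶` at `440`.
WHAT THIS IS NOT: no statement about STPP families or `ω` by itself (a Boolean search and its semantic vocabulary); nothing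
about orders `> 489`; the vQ instrument is itself blind from order `490` (eng-1 j274236: `(8,6,6)+(7,7,6)+(6,6,6)³`).
-/

set_option linter.dupNamespace false -- `MatrixMultiplication.MatrixMultiplication` (summit = problem, D-0017)
set_option autoImplicit false

namespace Summit.MatrixMultiplication.MatrixMultiplication.Theorems.ShapeCertVQ

open ShapeCert ShapeCertVP STPPThreeRoomEnergy

/-! ### Constants -/

/-- Largest order of the certificate (the order of the universe behind the static data). -/
def Mtop : ℕ := 489

/-- One plus the largest ratio level of the universe of order `489` (levels `≥ hiLev` never occur; `bsearch` upper end). -/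
def hiLev : ℕ := 59

/-- The level floor: every universe shape has level `> loLev`, so every shape is a search candidate and the `loLev` rows of the
tables are zero. -/
def loLev : ℕ := 11

/-! ### Shape records and candidate lists (as `ShapeCertVP`, gains from `gainQ`) -/

/-- The shape record of `(a,b,c)` at order `M` (fields as `ShapeCert.mkSh`, gain from `gainQ`). -/
def mkShQ (M a b c : ℕ) : Sh :=
  let g := gainQ (a * b * c)
  { a := a, b := b, c := c, V := a * b * c, ab := a * b, bc := b * c, ca := c * a,
    wA := a * (b + c), wB := b * (c + a), wC := c * (a + b), g := g,
    mpp := max (a * b) (max (b * c) (c * a)),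
    dab := a * b * c - a * b + (if hasLCD (a * b * c) M c then 0 else 1),
    dbc := a * b * c - b * c + (if hasLCD (a * b * c) M a then 0 else 1),
    dca := a * b * c - c * a + (if hasLCD (a * b * c) M b then 0 else 1),
    rho := g * K / (a * b + b * c + c * a) + 1,
    lev := min 63 (g * 64 / ((a * b + b * c + c * a) * D)) }

/-- The shape record of a triple. -/
def shQ (M : ℕ) (x : ℕ × ℕ × ℕ) : Sh := mkShQ M x.1 x.2.1 x.2.2

/-- The universe of member shapes at order `M` with first side `a = a' + 1`, `a' ∈ [lo, lo + n)` (membership test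
`ShapeCert.inUnivB`), records evaluated — used only by the one-time table and completeness checks at order `489`
(`…ShapeCertVQTables`, slice by slice), never by `checkQ`. -/
def univ0Q (M lo n : ℕ) : List Sh :=
  (List.range' lo n).flatMap fun a' => (List.range (M / (a' + 1))).flatMap fun b' =>
    (List.range (M / ((a' + 1) * (b' + 1)))).filterMap fun c' =>
      if inUnivB M (a' + 1) (b' + 1) (c' + 1) then (mkShQ M (a' + 1) (b' + 1) (c' + 1)).force some else none

/-- The candidate list at order `M`: the tabled triples (all levels, descending) that are universe members at order `M`, as
evaluated records. -/
def candQ (M : ℕ) : List Sh :=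
  candTriplesQ.filterMap fun x =>
    if inUnivB M x.1 x.2.1 x.2.2 then (mkShQ M x.1 x.2.1 x.2.2).force some else none

/-! ### The E3⁺ node kill (refined three-room energy, `STPPThreeRoomEnergy.three_room_energy_plus`, on shape data)

For member `t` of the prefix (aggregates `A`): the off-member packing sums of the PREFIX are `S_A = Σbc − bc_t`,
`S_B = Σca − ca_t`, `S_C = Σab − ab_t`; the member is dead when `2V_t > M` and `V_t² < e3pLHS M a_t b_t c_t S_A S_B S_C`
(`STPPThreeRoomEnergy.e3pLHS`, the literal hypothesis shape of `false_of_energy3p`).  A larger family has larger off-member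
sums and `e3pLHS` is monotone in them (`e3pLHS_mono`), so the kill is inherited by every completion of the prefix. -/

/-- E3⁺ kill of member `t` of a prefix with aggregates `A` at order `M`. -/
def e3pKillT (M : ℕ) (A : Agg) (t : Sh) : Bool :=
  seqN (A.sbc - t.bc) fun SA => seqN (A.sca - t.ca) fun SB => seqN (A.sab - t.ab) fun SC =>
    decide (M < 2 * t.V) && decide (t.V * t.V < e3pLHS M t.a t.b t.c SA SB SC)

/-- E3⁺ kill of a prefix: some member is killed. -/
def killE (M : ℕ) (A : Agg) (fam : List Sh) : Bool := fam.any (e3pKillT M A)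

/-! ### Table-dependent pieces of the search (verbatim `ShapeCertVP` with `tabRQ` / `tabGQ` / `loLev` / `hiLev`) -/

/-- budget `i` certifies «prefix gain + tail gain ≤ 10⁶·M» with the level-`L` Grynkiewicz table -/
def beClQ (g0 mdk L i : ℕ) : Option ℕ → Bool
  | none => false
  | some b => decide (g0 + b * (tabGQ L).get i ≤ mdk)

/-- some budget closes with table `L` -/
def clAnyQ (B : Buds) (g0 mdk L : ℕ) : Bool :=
  beClQ g0 mdk L 0 B.b0 || beClQ g0 mdk L 1 B.b1 || beClQ g0 mdk L 2 B.b2 ||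
    beClQ g0 mdk L 3 B.b3 || beClQ g0 mdk L 4 B.b4 || beClQ g0 mdk L 5 B.b5

/-- keep the better of the current selection and parameter `i` with optional budget (value `budget · (tabGQ L) i`) -/
def gpickQ (L : ℕ) (cur : GSel) (i : ℕ) (ob : Option ℕ) : GSel :=
  match ob with
  | none => cur
  | some b =>
    seqN (b * (tabGQ L).get i) fun v => if cur.ok && decide (cur.val ≤ v) then cur else ⟨true, b, i, v⟩

/-- the node's Grynkiewicz selection for the in-walk break test (table of the node's own level `L`) -/
def gnodeQ (L : ℕ) (B : Buds) : GSel :=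
  gpickQ L (gpickQ L (gpickQ L (gpickQ L (gpickQ L (gpickQ L ⟨false, 0, 0, 0⟩ 0 B.b0) 1 B.b1) 2 B.b2) 3 B.b3) 4 B.b4) 5 B.b5

/-- One candidate step (as `ShapeCertVP.stepV`): the first-member test, the continuation bound of the extended prefix,
admissibility, the U11-G kill, the recursion. -/
def stepQ (M : ℕ) (rec : List Sh → List Sh → Bool) (t : Sh) (A : Agg) (fam : List Sh) (g0 q : ℕ) (sel : B8 → ℕ)
    (mdk : ℕ) (rest : List Sh) : Bool :=
  if g0 + t.g * K + sel (tabRQ t.lev) * min q ((3 * M + (t.a + t.b + t.c)) / 2 - uuA A - (t.ab + t.bc + t.ca)) ≤ mdk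
  then true
  else
    (A.push t).force fun P =>
      if P.prune M (tabRQ t.lev) then true
      else if feasP M P t (!fam.isEmpty) A.mxV A.mxP (t :: fam) then
        (if killV M P (t :: fam) then true else rec (t :: fam) (t :: rest))
      else true

/-- One DFS level (as `ShapeCertVP.loopV`): break below level `lb1`, skip candidates over the budgets, step the others,
close with `cl` at the end of the list. -/
def loopQ (M : ℕ) (rec : List Sh → List Sh → Bool) (fam : List Sh) (A : Agg)
    (ra rb rc vl g0 q : ℕ) (sel : B8 → ℕ) (mdk lb1 : ℕ) (cl : Bool) : List Sh → Bool
  | [] => cl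
  | t :: rest =>
    if t.lev < lb1 then true
    else if ra < t.wA ∨ rb < t.wB ∨ rc < t.wC ∨ vl < t.V then loopQ M rec fam A ra rb rc vl g0 q sel mdk lb1 cl rest
    else stepQ M rec t A fam g0 q sel mdk rest && loopQ M rec fam A ra rb rc vl g0 q sel mdk lb1 cl rest

/-- the break level (plus one) of a node (as `ShapeCertVP.breakLev`, binary searches on `[loLev, hiLev)`) -/
def breakLevQ (g0 q : ℕ) (sel : B8 → ℕ) (mdk : ℕ) (gb : Bool) (gB gi : ℕ) : ℕ :=
  seqN (bsearch (fun L => decide (g0 + sel (tabRQ L) * q ≤ mdk)) 7 loLev hiLev) fun r =>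
  seqN (if gb then bsearch (fun L => decide (g0 + gB * (tabGQ L).get gi ≤ mdk)) 7 loLev hiLev else loLev) fun g =>
    if max r g ≤ loLev then 0 else max r g

/-- the ratio level of the newest member of a prefix (`loLev` for the empty prefix — unused) -/
def headLevQ : List Sh → ℕ
  | [] => loLev
  | t :: _ => t.lev

/-- The DFS with fuel (as `ShapeCertVP.dfsV` plus the E3⁺ kill in front): an E3⁺-dead prefix has no admissible beating
completion; a beating E3⁺-alive prefix refutes the certificate; a dead prefix has no extensions; a prefix whose Grynkiewicz
budget admits no member, or whose bound cannot beat, is pruned; otherwise walk the candidates. -/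
def dfsQ (M : ℕ) : ℕ → List Sh → List Sh → Bool
  | 0, _, _ => false
  | n + 1, fam, L =>
    (aggOf M fam).force fun A =>
      if killE M A fam then true
      else if M * D < A.gs then false
      else if A.dead M then true
      else
        let Bs := budsOf M A fam
        if Bs.tailEmpty then decide (A.gs ≤ M * D)
        else
          let S := gnodeQ (headLevQ fam) Bs
          seqN S.bud fun gB => seqN S.idx fun gi =>
            if S.ok && decide (A.gs * K + gB * (tabGQ (headLevQ fam)).get gi ≤ M * D * K) then true
            else
              seqN (A.ra M) fun ra => seqN (A.rb M) fun rb => seqN (A.rc M) fun rc => seqN (A.vl M) fun vl =>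
              seqN (A.gs * K) fun g0 => seqN (A.q0 M) fun q => seqN (A.kOf M) fun k => seqN (M * D * K) fun mdk =>
              seqN (breakLevQ g0 q (selOf k) mdk S.ok gB gi) fun lb1 =>
                let cl := fam.isEmpty || decide (g0 + selOf k (tabRQ loLev) * q ≤ mdk) || clAnyQ Bs g0 mdk loLev
                loopQ M (dfsQ M n) fam A ra rb rc vl g0 q (selOf k) mdk lb1 cl L

/-- The vQ certificate checker at order `M` (`M ≤ Mtop`). -/
def checkQ (M : ℕ) : Bool := dfsQ M (M + 2) [] (candQ M)

/-! ### Root segments (splitting one order into several kernel evaluations)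

At the root (empty prefix) `checkQ M` walks the candidates `t₀, t₁, …` of `candQ M` in order, stepping candidate `k` with the
continuation pool `t_k, t_{k+1}, …`.  `rootLoopQ … n L` is that walk restricted to the first `n` candidates of `L` (each with its
full pool), `rootSegQ M i n` runs it on `(candQ M).drop i` with the root's constants, and `…ShapeCertVQSearch.checkQ_of_rootSegs`
assembles segments covering `[0, |candQ M|)` into `checkQ M = true`. -/

/-- The root walk restricted to the first `n` candidates of the list (break, skip and step exactly as `loopQ` with `cl = true`). -/
def rootLoopQ (M : ℕ) (rec : List Sh → List Sh → Bool) (A : Agg) (ra rb rc vl g0 q : ℕ) (sel : B8 → ℕ) (mdk lb1 : ℕ) :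
    ℕ → List Sh → Bool
  | _, [] => true
  | 0, _ :: _ => true
  | n + 1, t :: rest =>
    if t.lev < lb1 then true
    else if ra < t.wA ∨ rb < t.wB ∨ rc < t.wC ∨ vl < t.V then rootLoopQ M rec A ra rb rc vl g0 q sel mdk lb1 n rest
    else stepQ M rec t A [] g0 q sel mdk rest && rootLoopQ M rec A ra rb rc vl g0 q sel mdk lb1 n rest

/-- The root's break level at order `M` (no Grynkiewicz budget exists for the empty prefix). -/
def rootLb1 (M : ℕ) : ℕ :=
  breakLevQ ((aggOf M []).gs * K) ((aggOf M []).q0 M) (selOf ((aggOf M []).kOf M)) (M * D * K) false 0 0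

/-- Root segment: the root steps of the candidates `i, …, i + n − 1` of `candQ M` (each with its full continuation pool) pass. -/
def rootSegQ (M i n : ℕ) : Bool :=
  (aggOf M []).force fun A =>
    seqN (A.ra M) fun ra => seqN (A.rb M) fun rb => seqN (A.rc M) fun rc => seqN (A.vl M) fun vl =>
    seqN (A.gs * K) fun g0 => seqN (A.q0 M) fun q => seqN (A.kOf M) fun k => seqN (M * D * K) fun mdk =>
    seqN (rootLb1 M) fun lb1 =>
      rootLoopQ M (dfsQ M (M + 1)) A ra rb rc vl g0 q (selOf k) mdk lb1 n ((candQ M).drop i)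

/-! ### One-time data checks (evaluated by the kernel in `…ShapeCertVQTables`, at order `489`, slice by slice) -/

/-- the static tables dominate the record `s`: `rho ≤ tabRQ (lev s) k` for every admitting volume bucket `k`, and
`qh_t ≤ tabGQ (lev s) i` for the six parameters -/
def tabOKQ (s : Sh) : Bool :=
  (List.range 8).all (fun k => !capOK k s.V || decide (s.rho ≤ (tabRQ s.lev).get k)) &&
    (List.range 6).all (fun i => decide (qh (tOf i) s ≤ (tabGQ s.lev).get i))

/-- the record's level lies in `(loLev, hiLev)` and the record is tabled at its level -/
def litOKQ (s : Sh) : Bool := decide (loLev < s.lev) && decide (s.lev < hiLev) && decide (s.tr ∈ litLevQ s.lev)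

/-- both one-time checks -/
def allOKQ (s : Sh) : Bool := tabOKQ s && litOKQ s

/-! ### Semantic vocabulary (statements only; the theorems are in `…ShapeCertVQ{Semantics,…}`)

Triple-level versions of the record fields with the extended gains, the E3⁺ condition on multisets (`AdmE`; vQ admissibility is
`ShapeCert.AdmM ∧ ShapeCertVP.AdmG ∧ AdmE`), the total gain `gsumQ`, well-formed record lists `WfQ`, the standing hypotheses
`AboveQ` of the search induction and its goal `GoalQ`. -/

section trip
variable (x : ℕ × ℕ × ℕ)

/-- integer gain of a triple (extended table) -/
def gTQ : ℕ := gainQ (vol x)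
/-- scaled gain/packing ratio -/
def rhoTQ : ℕ := gTQ x * K / uu x + 1
/-- ratio level -/
def levTQ : ℕ := min 63 (gTQ x * 64 / (uu x * D))
/-- scaled gain/weight ratio -/
def qhTQ (t : ℕ) : ℕ := gTQ x * K / whT x t + 1

end trip

/-- **The E3⁺ condition on a multiset of triples at order `M`** (multiset form of `STPPThreeRoomEnergy.E3pAdm`): every member `x`
with `2·vol x > M` satisfies `e3pLHS ≤ (vol x)²` with the off-member packing sums of the multiset (one copy of `x` removed). [original] -/
def AdmE (M : ℕ) (G : Multiset (ℕ × ℕ × ℕ)) : Prop :=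
  ∀ x ∈ G, M < 2 * vol x →
    e3pLHS M x.1 x.2.1 x.2.2 ((G.erase x).map pbc).sum ((G.erase x).map pca).sum ((G.erase x).map pab).sum ≤ vol x ^ 2

/-- total integer gain of a shape multiset (extended table) -/
def gsumQ (G : Multiset (ℕ × ℕ × ℕ)) : ℕ := (G.map gTQ).sum

/-- every record of the list is the record of its own triple [bookkeeping] -/
def WfQ (M : ℕ) (l : List Sh) : Prop := ∀ t ∈ l, t = shQ M t.tr

/-- Standing hypotheses of the search induction: a vQ-admissible family `G` inside the universe of order `M ≤ Mtop`, above
the well-formed prefix `fam`. [bookkeeping] -/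
structure AboveQ (M : ℕ) (G : Multiset (ℕ × ℕ × ℕ)) (fam : List Sh) : Prop where
  /-- the order is inside the range of the static data -/
  hM : M ≤ Mtop
  /-- all members are universe shapes -/
  univ : ∀ x ∈ G, InUniv M x
  /-- the vM system -/
  adm : AdmM M G
  /-- rule U11-G in credit form -/
  admG : AdmG M G
  /-- rule E3⁺ -/
  admE : AdmE M G
  /-- the prefix is well formed -/
  wf : WfQ M fam
  /-- the family lies above the prefix -/
  le : famT fam ≤ G

/-- What the search below the prefix `fam` with remaining candidate list `R` guarantees: no vQ-admissible family above the
prefix beats, provided every tail member is listed in `R` or has ratio level `≤ loLev`. [bookkeeping] -/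
def GoalQ (M : ℕ) (fam R : List Sh) : Prop :=
  ∀ G : Multiset (ℕ × ℕ × ℕ), AboveQ M G fam → M * D < gsumQ G →
    (∀ x ∈ G - famT fam, levTQ x ≤ loLev ∨ shQ M x ∈ R) → False

/-- Side conditions on a candidate list: well-formed records inside the universe, levels non-increasing. [bookkeeping] -/
structure PoolOKQ (M : ℕ) (R : List Sh) : Prop where
  /-- well formed -/
  wf : WfQ M R
  /-- inside the universe -/
  univ : ∀ t ∈ R, InUniv M t.tr
  /-- levels non-increasing -/
  sorted : R.Pairwise (fun s t => t.lev ≤ s.lev)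

end Summit.MatrixMultiplication.MatrixMultiplication.Theorems.ShapeCertVQ
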